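import Summits.CriticalPhenomena.PercolationContinuityZ3.Theorems.Transplant.SkelKitStepIV
import HarnessLib

/-!
# L5.7 companion (generic design-(D) re-typing) — Step IV at a contact whose target route is given as a LINK PROBABILITY
# (`kit_hIV_of_route`: the general form of `Skel.kit_hIV_of_le` agreed in the lane, hp-8 g24 20:39:55Z / p3-g4 20:5xZ; the straight
# route of `kit_hIV_of_le` is the special case `Skel.hcon_of_straight`)

builds on p205010 (kernel theorem, internal audit signed; external expert review pending) — nothing in this file uses p205010.
Lane `prim-bschramm`, seat `prim-bschramm-p3` (gen 4); helper file (`--supports stmt-CriticalPhenomena-4575 --as helper`).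

`Skel.kit_hIV_of_le` (p1-g7, `SkelKitStepIV`) feeds `KNLevels.stepIV_in` with a STRAIGHT route: a prism `fatSeq c ℓ ⊆ D` whose quarter-face
lies in the target.  The face residue (F) cannot use a straight route — a deep contact of the face step reaches the true target only through
the elongated inner run (KN Lemma 11), whose output is a link probability.  `kit_hIV_of_route` therefore takes the route in the probabilistic
form of `stepIV_in`'s `h3`, universally quantified over the type representative `t` that carries the inputs at the cube centre `c` (so that
the consumer's route shares the inner scale `msel t` with the cube's zone and links, `Skel.exists_inputs_at_center_all`):
`hroute : ∀ t ∈ Φ.types, (inputs at c for every scale of S, inner scale msel t) → ∃ Qt Ft, Ft ⊆ T ∧ Qt ⊆ D ∧ (G-edges inside Qt are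
Γ-edges) ∧ Disjoint Ft (fatSeq c M) ∧ P_{Wt}(fatSeq c (msel t) ↔ Ft inside Qt) > 1 - δ²`.
Conclusion: the `hIV` clause of the target lemma at the contact, `1 - 3δ ≤ P_{Wt}{∃ u ∈ U, P(u ↔ T in D | ω|_{Spin}) > 1 - δ}`.

[cite: KozmaNitzan2024, §4 pp. 19–21 ((21)–(25), Step IV), Lemma 11 (p. 23: the route from the cube through the corridor)]
-/

noncomputable section

open MeasureTheory

namespace Summit.CriticalPhenomena.PercolationContinuityZ3.Theorems

namespace Transplant

namespace Skel

open Literature.Probability.Percolation Literature.Probability.LatticeModels SimpleGraph KNLevels KozmaNitzan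
open Literature.Probability.Percolation.GM (HOct)
open scoped Classical

variable {V : Type} {G : SimpleGraph V} [G.LocallyFinite] (Φ : PlanarSkeletonConc G)

/-- **Step IV at a contact with a probabilistic target route** (general form of `kit_hIV_of_le`).  Setting: the input family at `q` with
margin `δ²` (`hin`), the cube scale `M ∈ S` with `msel ≤ M` on `Φ.types`, an exploration graph `Γ ≤ G` with a subbox weighting `Wt` on `D`,
the pinned set `Spin ⊆ D` containing the cube `fatSeq c M` (inside `G`-edges of the cube `Γ`-edges), the face `U = macroPiece c M (ψ M) g`
on the cube's inner boundary in `Γ`, and the ROUTE HYPOTHESIS `hroute` (for every representative `t` carrying the inputs at `c`: some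
`Qt ⊆ D`, `Ft ⊆ T` off the cube with `P_{Wt}(fatSeq c (msel t) ↔ Ft inside Qt) > 1 - δ²`).  Conclusion: the `hIV` clause of the target
lemma. [cite: KozmaNitzan2024, §4 pp. 19–21 ((21)–(25)), Lemma 11 (p. 23)] -/
theorem kit_hIV_of_route [Countable V] {p : unitInterval} (hC : Φ.toPlanarSkeleton.CylSubcritical p) (msel : V → ℕ) {S : Finset ℕ}
    {q : unitInterval} {δ : ℝ} (hδ : 0 < δ)
    (hin : ∀ i ∈ inputIndex Φ S, 1 - δ ^ 2 < (bondPercolation G q).real (inputEvent Φ hC msel i))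
    {M : ℕ} (hM : M ∈ S) (hmsel : ∀ t ∈ Φ.types, msel t ≤ M)
    {Γ : SimpleGraph V} [Γ.LocallyFinite] (hΓ : Γ ≤ G) {Wt : Sym2 V → unitInterval} {D Spin T : Finset V} (hWD : IsSubbox Γ Wt q D)
    (hSD : Spin ⊆ D) {c : V} (hQS : fatSeq Φ hC c M ⊆ Spin)
    (hQΓ : ∀ u ∈ fatSeq Φ hC c M, ∀ v ∈ fatSeq Φ hC c M, G.Adj u v → Γ.Adj u v)
    {U : Finset V} (g : HOct 2) (hUg : U = macroPiece Φ c M (fatRadius Φ hC M) g) (hUib : U ⊆ innerBoundary Γ (fatSeq Φ hC c M))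
    (hroute : ∀ t ∈ Φ.types,
      (∀ M' ∈ S, 1 - δ ^ 2 < (bondPercolation G q).real (UniqZone.zone G (fatSeq Φ hC c) (msel t) M') ∧
        ∀ g' : HOct 2, 1 - δ ^ 2 < (bondPercolation G q).real
          (linkIn (↑(fatSeq Φ hC c M')) (fatSeq Φ hC c (msel t)) (macroPiece Φ c M' (fatRadius Φ hC M') g'))) →
      ∃ Qt Ft : Finset V, Ft ⊆ T ∧ Qt ⊆ D ∧ (∀ u ∈ Qt, ∀ v ∈ Qt, G.Adj u v → Γ.Adj u v) ∧ Disjoint Ft (fatSeq Φ hC c M) ∧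
        1 - δ ^ 2 < (prodBernoulli Wt).real (linkIn (↑Qt) (fatSeq Φ hC c (msel t)) Ft)) :
    1 - 3 * δ ≤ (prodBernoulli Wt).real {ω | ∃ u ∈ U,
      1 - δ < (prodBernoulli (pinW Wt (wireSet (↑Spin : Set V)) ω)).real (⋃ t ∈ T, openConnIn (↑D : Set V) u t)} := by
  obtain ⟨t, ht, hall⟩ := exists_inputs_at_center_all Φ hC msel hin c
  obtain ⟨h1, h2⟩ := inputs_at_center_of_le Φ hC hΓ hWD (hQS.trans hSD) hQΓ (hall M hM).1 (hall M hM).2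
  obtain ⟨Qt, Ft, hFT, hQD, -, hdisj, h3⟩ := hroute t ht hall
  have hkn : fatSeq Φ hC c (msel t) ⊆ fatSeq Φ hC c M := fatSeq_monotone Φ hC c (hmsel t ht)
  have h2' : 1 - δ ^ 2 < (prodBernoulli Wt).real (linkIn (↑(fatSeq Φ hC c M)) (fatSeq Φ hC c (msel t)) U) := by rw [hUg]; exact h2 g
  exact stepIV_in (G := Γ) (S := Spin) hWD hFT hQD (fatSeq Φ hC c) hkn hQS hUib hdisj hδ (Rg := (↑D : Set V))
    (Finset.coe_subset.2 (hQS.trans hSD)) (Finset.coe_subset.2 hQD) h1 h2' h3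

/-! ## Binder form (lane convention `[DecidableEq V]`; the statement above carries the classical instance) -/

section Binder

variable [DecidableEq V]

/-- **Step IV at a contact with a probabilistic target route — instance-polymorphic form** of `kit_hIV_of_route` (identical statement and
proof under a `[DecidableEq V]` binder, so that callers following the lane's binder convention — `SkelI.*`, `SkelKits` — can apply it; the
unprimed version above elaborated `IsSubbox` / `innerBoundary` / `inputEvent` / `pinW` at the classical instance).
[cite: KozmaNitzan2024, §4 pp. 19–21 ((21)–(25)), Lemma 11 (p. 23)] -/
theorem kit_hIV_of_route' [Countable V] {p : unitInterval} (hC : Φ.toPlanarSkeleton.CylSubcritical p) (msel : V → ℕ) {S : Finset ℕ}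
    {q : unitInterval} {δ : ℝ} (hδ : 0 < δ)
    (hin : ∀ i ∈ inputIndex Φ S, 1 - δ ^ 2 < (bondPercolation G q).real (inputEvent Φ hC msel i))
    {M : ℕ} (hM : M ∈ S) (hmsel : ∀ t ∈ Φ.types, msel t ≤ M)
    {Γ : SimpleGraph V} [Γ.LocallyFinite] (hΓ : Γ ≤ G) {Wt : Sym2 V → unitInterval} {D Spin T : Finset V} (hWD : IsSubbox Γ Wt q D)
    (hSD : Spin ⊆ D) {c : V} (hQS : fatSeq Φ hC c M ⊆ Spin)
    (hQΓ : ∀ u ∈ fatSeq Φ hC c M, ∀ v ∈ fatSeq Φ hC c M, G.Adj u v → Γ.Adj u v)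
    {U : Finset V} (g : HOct 2) (hUg : U = macroPiece Φ c M (fatRadius Φ hC M) g) (hUib : U ⊆ innerBoundary Γ (fatSeq Φ hC c M))
    (hroute : ∀ t ∈ Φ.types,
      (∀ M' ∈ S, 1 - δ ^ 2 < (bondPercolation G q).real (UniqZone.zone G (fatSeq Φ hC c) (msel t) M') ∧
        ∀ g' : HOct 2, 1 - δ ^ 2 < (bondPercolation G q).real
          (linkIn (↑(fatSeq Φ hC c M')) (fatSeq Φ hC c (msel t)) (macroPiece Φ c M' (fatRadius Φ hC M') g'))) →
      ∃ Qt Ft : Finset V, Ft ⊆ T ∧ Qt ⊆ D ∧ (∀ u ∈ Qt, ∀ v ∈ Qt, G.Adj u v → Γ.Adj u v) ∧ Disjoint Ft (fatSeq Φ hC c M) ∧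
        1 - δ ^ 2 < (prodBernoulli Wt).real (linkIn (↑Qt) (fatSeq Φ hC c (msel t)) Ft)) :
    1 - 3 * δ ≤ (prodBernoulli Wt).real {ω | ∃ u ∈ U,
      1 - δ < (prodBernoulli (pinW Wt (wireSet (↑Spin : Set V)) ω)).real (⋃ t ∈ T, openConnIn (↑D : Set V) u t)} := by
  obtain ⟨t, ht, hall⟩ := exists_inputs_at_center_all Φ hC msel hin c
  obtain ⟨h1, h2⟩ := inputs_at_center_of_le Φ hC hΓ hWD (hQS.trans hSD) hQΓ (hall M hM).1 (hall M hM).2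
  obtain ⟨Qt, Ft, hFT, hQD, -, hdisj, h3⟩ := hroute t ht hall
  have hkn : fatSeq Φ hC c (msel t) ⊆ fatSeq Φ hC c M := fatSeq_monotone Φ hC c (hmsel t ht)
  have h2' : 1 - δ ^ 2 < (prodBernoulli Wt).real (linkIn (↑(fatSeq Φ hC c M)) (fatSeq Φ hC c (msel t)) U) := by rw [hUg]; exact h2 g
  exact stepIV_in (G := Γ) (S := Spin) hWD hFT hQD (fatSeq Φ hC c) hkn hQS hUib hdisj hδ (Rg := (↑D : Set V))
    (Finset.coe_subset.2 (hQS.trans hSD)) (Finset.coe_subset.2 hQD) h1 h2' h3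

end Binder

end Skel

end Transplant

end Summit.CriticalPhenomena.PercolationContinuityZ3.Theorems

end
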